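import Mathlib
import Summits.KontsevichZagierPeriods.KontsevichZagierPeriods.Theorems.InverseLandauTateFamilyKernelStubTauAdicDigits

/-!
# Crux `TateFamilyKernel` (stmt-KontsevichZagierPeriods-9130), line `Sketch` — `stub_digitsMv`
# (wave 15, lead c4: a face remainder vanishing along the polar curve is zero)

For the Euler sector of the lead's skeleton of the crux
`Summit.KontsevichZagierPeriods.KontsevichZagierPeriods.Theses.InverseLandau.TateFamilyKernel`:
the Hermite remainder `Ã(s,ϖ)` of one face has `s`-degree `< deg τ` (`τ(s) = T(1,s)` the face
restriction of the pencil). The Stieltjes step shows that the `ϖ`-independent density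
`Ã(s, 1/τ(s))` vanishes on an infinite set of `s`; this file concludes `Ã = 0`: clearing the powers of
`τ`, `τ(s)^M·Ã(s,1/τ(s)) = Σ_j a_j(s) τ(s)^{M−j}` with the "digits" `a_j = Σ_i Ã_{ij} s^i` of degree
`< deg τ`, a one-variable polynomial vanishing on an infinite set, hence zero, hence all digits vanish by
the uniqueness of `τ`-adic digits (`stub_tauAdicDigits`, landed), hence every coefficient of `Ã` vanishes.
Variables: `X 0 = s`, `X 1 = ϖ`. Mathlib + the landed digits lemma; no named fact, no new definition.
-/

noncomputable section

open MeasureTheory Set MvPolynomial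

namespace Summit.KontsevichZagierPeriods.InverseLandau.TateFamilyKernel.Descent

namespace DigitsMv

/-- A finitely supported function on `Fin 2` is determined by its two values. [folklore] -/
theorem finsupp_fin_two_eq {m m' : Fin 2 →₀ ℕ} (h0 : m' 0 = m 0) (h1 : m' 1 = m 1) : m' = m := by
  ext i
  fin_cases i
  · exact h0
  · exact h1

/-- Evaluation of a two-variable polynomial as a sum over its support:
`A(x,y) = Σ_m A_m x^{m₀} y^{m₁}`. [folklore] -/
theorem aeval_eq_sum_support (A : MvPolynomial (Fin 2) ℚ) (x y : ℝ) :
    aeval (![x, y] : Fin 2 → ℝ) A = ∑ m ∈ A.support, ((coeff m A : ℚ) : ℝ) * (x ^ (m 0) * y ^ (m 1)) := by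
  conv_lhs => rw [A.as_sum]
  rw [map_sum]
  refine Finset.sum_congr rfl fun m _ => ?_
  rw [aeval_monomial, Finsupp.prod_fintype _ _ (fun i => by simp), Fin.prod_univ_two]
  simp

end DigitsMv

/-- **A face remainder vanishing along the polar curve is zero** (wave 15 of the lead's skeleton).
If `τ ∈ ℚ[s]` is non-constant, `A ∈ ℚ[s,ϖ]` has `s`-degree `< deg τ`, and `A(s, 1/τ(s)) = 0` for all `s`
in an infinite set of reals on which `τ ≠ 0`, then `A = 0`. [folklore: uniqueness of `τ`-adic digits] -/
theorem stub_digitsMv (τ : Polynomial ℚ) (hτ : 0 < τ.natDegree) (A : MvPolynomial (Fin 2) ℚ)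
    (hA : A.degreeOf 0 < τ.natDegree) (S : Set ℝ) (hS : S.Infinite)
    (hτS : ∀ s ∈ S, Polynomial.aeval s τ ≠ 0)
    (hvan : ∀ s ∈ S, aeval (![s, (Polynomial.aeval s τ)⁻¹] : Fin 2 → ℝ) A = 0) : A = 0 := by
  classical
  set M : ℕ := A.degreeOf 1 with hM
  -- the digits `a j = Σ_{m : m 1 = j} A_m X^{m 0}`
  set a : ℕ → Polynomial ℚ := fun j =>
    ∑ m ∈ A.support.filter (fun m => m 1 = j), Polynomial.C (coeff m A) * Polynomial.X ^ (m 0) with ha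
  have hm0 : ∀ m ∈ A.support, m 0 ≤ A.degreeOf 0 := fun m hm => monomial_le_degreeOf 0 hm
  have hm1 : ∀ m ∈ A.support, m 1 ≤ M := fun m hm => monomial_le_degreeOf 1 hm
  have hdeg : ∀ j, (a j).natDegree < τ.natDegree := by
    intro j
    refine lt_of_le_of_lt (Polynomial.natDegree_sum_le_of_forall_le _ _ fun m hm => ?_) hA
    exact (Polynomial.natDegree_C_mul_X_pow_le _ _).trans (hm0 m (Finset.mem_filter.1 hm).1)
  -- `G := Σ_j a_j τ^{M−j}` evaluates to `τ(s)^M · A(s, 1/τ(s))`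
  set G : Polynomial ℚ := ∑ j ∈ Finset.range (M + 1), a j * τ ^ (M - j) with hG
  have hGeval : ∀ s ∈ S, Polynomial.aeval s G =
      (Polynomial.aeval s τ) ^ M * aeval (![s, (Polynomial.aeval s τ)⁻¹] : Fin 2 → ℝ) A := by
    intro s hs
    set t : ℝ := Polynomial.aeval s τ with ht
    have ht0 : t ≠ 0 := hτS s hs
    rw [DigitsMv.aeval_eq_sum_support, Finset.mul_sum]
    rw [← Finset.sum_fiberwise_of_maps_to (s := A.support) (t := Finset.range (M + 1))
      (g := fun m : Fin 2 →₀ ℕ => m 1) (fun m hm => Finset.mem_range.2 (Nat.lt_succ_of_le (hm1 m hm)))]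
    rw [hG, map_sum]
    refine Finset.sum_congr rfl fun j hj => ?_
    rw [map_mul, map_pow, ha]
    simp only [map_sum, map_mul, Polynomial.aeval_C, map_pow, Polynomial.aeval_X, Finset.sum_mul]
    refine Finset.sum_congr rfl fun m hm => ?_
    have hmj : m 1 = j := (Finset.mem_filter.1 hm).2
    have hjM : j ≤ M := Nat.lt_succ_iff.1 (Finset.mem_range.1 hj)
    rw [← hmj] at hjM ⊢
    have hpow : t ^ M * (t⁻¹) ^ (m 1) = t ^ (M - m 1) := by
      rw [inv_pow, ← div_eq_mul_inv, pow_sub₀ _ ht0 hjM, div_eq_mul_inv]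
    simp only [eq_ratCast]
    rw [← ht]
    calc ((coeff m A : ℚ) : ℝ) * s ^ (m 0) * t ^ (M - m 1)
        = ((coeff m A : ℚ) : ℝ) * s ^ (m 0) * (t ^ M * (t⁻¹) ^ (m 1)) := by rw [hpow]
      _ = t ^ M * (((coeff m A : ℚ) : ℝ) * (s ^ (m 0) * t⁻¹ ^ (m 1))) := by ring
  -- hence `G` vanishes on the infinite set `S`, so `G = 0`
  have hG0 : G = 0 := by
    have hmap : G.map (algebraMap ℚ ℝ) = 0 := by
      refine Polynomial.eq_zero_of_infinite_isRoot _ (hS.mono fun s hs => ?_)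
      rw [Set.mem_setOf_eq, Polynomial.IsRoot.def, Polynomial.eval_map_algebraMap, hGeval s hs,
        hvan s hs, mul_zero]
    exact (Polynomial.map_eq_zero_iff (algebraMap ℚ ℝ).injective).1 hmap
  -- all digits vanish
  have hdig : ∀ j ≤ M, a j = 0 := stub_tauAdicDigits τ hτ M a hdeg (by rw [← hG, hG0])
  -- hence every coefficient of `A` vanishes
  by_contra hA0
  obtain ⟨m, hm⟩ : A.support.Nonempty :=
    Finset.nonempty_of_ne_empty (by rwa [Ne, MvPolynomial.support_eq_empty])
  have hj := hdig (m 1) (hm1 m hm)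
  have hcoef : (a (m 1)).coeff (m 0) = coeff m A := by
    rw [ha]
    simp only [Polynomial.finsetSum_coeff, Polynomial.coeff_C_mul_X_pow]
    rw [Finset.sum_eq_single m]
    · rw [if_pos rfl]
    · intro m' hm' hne
      rw [if_neg]
      intro h0
      exact hne (DigitsMv.finsupp_fin_two_eq h0.symm (Finset.mem_filter.1 hm').2)
    · intro hnot
      exact absurd (Finset.mem_filter.2 ⟨hm, (rfl : m 1 = m 1)⟩) hnot
  rw [hj, Polynomial.coeff_zero] at hcoef
  exact (mem_support_iff.1 hm) hcoef.symm

end Summit.KontsevichZagierPeriods.InverseLandau.TateFamilyKernel.Descent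

end
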